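import Summits.BirchSwinnertonDyer.BirchSwinnertonDyer.Theses.KolyvaginDepthDoor
import Literature.NumberTheory.EllipticCurves.BSDRankZeroDensityProofs
import Literature.NumberTheory.EllipticCurves.BSDSelmerParityDokchitserBaseChangeProofs
import Literature.NumberTheory.EllipticCurves.LeadingTermProofs
import Literature.NumberTheory.EllipticCurves.TwoIsogenyShaTwoTorsion
import HarnessLib

/-!
# Route `KolyvaginDepthDoor`, crux `KolyvaginDepthSupply` (stmt-BirchSwinnertonDyer-21765) —
# the READING of a Selmer count over the Heegner field: `#Sel_p(E/K) ≤ p^{r + r'}` with `r`, `r'`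
# known points on `E`, `E^{(d_K)}` forces `corank Ш(E/ℚ)[p^∞] = 0`

Helper file (`--supports stmt-BirchSwinnertonDyer-21765 --as helper`); route-independent (the
route file is imported only for the summit's vocabulary); it closes nothing and BSD is not proved
by it. UNCONDITIONAL: every input is a proved theorem of the tree.

Purpose. The sibling Literature file `HeegnerPointsKolyvaginDepthDescent` (Kolyvagin's descent at
the minimal depth, mod `p`: `KolyvaginDescent.HypothesesDepth.card_sel_le_of_ne_zero`) turns ONE
non-zero Kolyvagin class `c(n₁) ≠ 0` of depth `ν₁` into the count `#Sel(E/K)_p ≤ p^{2ν₁+1}` — for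
the depth-table rows of this route (`n₁ = ℓ`, `ν₁ = 1`): `#Sel(E/K)_p ≤ p³`. This file is the
second half of the hF-free door: it reads such a count against known rational points.

* `rank_and_shaCorank_of_natCard_selmerGroup_baseChange_le` — for `E/ℚ` elliptic, `K` quadratic,
  any prime `p` and `a ≤ rank E(ℚ)`, `b ≤ rank E^{(d_K)}(ℚ)`: if `#Sel_p(E/K) ≤ p^{a+b}` then
  `rank E(ℚ) = a`, `rank E^{(d_K)}(ℚ) = b`, `E(K)[p] = 0`, `Ш(E/K)[p] = 0`, and
  `corank_{ℤ_p} Ш(E/ℚ)[p^∞] = corank_{ℤ_p} Ш(E^{(d_K)}/ℚ)[p^∞] = corank_{ℤ_p} Ш(E/K)[p^∞] = 0`.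
  Proof: the exact descent count `#Sel_p(E/K) = p^{rank E(K)} · #E(K)[p] · #Ш(E/K)[p]`
  (`natCard_selmerGroup_eq`, Silverman X.4.2) with `rank E(K) = rank E(ℚ) + rank E^{(d_K)}(ℚ)`
  (`mordellWeilRank_baseChange_quadratic_holds`, AEC Ex. 10.16) pins every factor; `Ш(E/K)[p] = 0`
  gives `corank Ш(E/K)[p^∞] = 0` (`shaCorank_eq_zero_of_forall`); the Kummer identities
  (`selmerCorank_eq_mordellWeilRank_add_holds`) over `K` and over `ℚ` with
  `corank Sel_{p^∞}(E/K) = corank Sel_{p^∞}(E/ℚ) + corank Sel_{p^∞}(E^{(d_K)}/ℚ)`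
  (`selmerCorank_baseChange_quadratic_holds`, Dokchitser–Dokchitser) descend it to `ℚ`.
* `shaCorank_eq_zero_of_natCard_selmerGroup_baseChange_le_cube` — the rank-2 door's reading:
  `#Sel_p(E/K) ≤ p³`, two independent points on `E(ℚ)` and one point of infinite order on
  `E^{(d_K)}(ℚ)` give `t_p(E) = 0` (and `rank E(ℚ) = 2`, `rank E^{(d_K)}(ℚ) = 1`, `Ш(E/K)[p] = 0`).

So a depth-table row `(E, p, K, ℓ)` reads, WITHOUT Kolyvagin's structure theorem (the named fact
`Kolyvagin1991_selmerCorank_of_kolyvaginClass_ne_zero` carried by every earlier row file): the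
computed bit `c_1(ℓ) ≠ 0` ⟹ `#Sel(E/K)_p ≤ p³` (Literature, modulo the Euler-system leaves of
Gross 1991 §§3–8) ⟹ with the row's point certificates, `corank_{ℤ_p} Ш(E/ℚ)[p^∞] = 0`. The extra
input relative to the hF-rows is ONE rational point of infinite order on the twist `E^{(d_K)}`
(kernel-checkable per row); the hF-rows obtained `corank Sel_{p^∞}(E^{(d_K)}/ℚ) = 1` from
Kolyvagin's exact clause instead.

References: [SilvermanAEC2009] Thm. X.4.2, Exercise 10.16; [Greenberg1999] §1 (Kummer identity);
[DokchitserDokchitserAnnals2010] Lemma 4.14 (Selmer corank over a quadratic extension).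
-/

set_option linter.dupNamespace false

noncomputable section

open scoped Classical

namespace Summit.BirchSwinnertonDyer.BirchSwinnertonDyer.Theorems.KolyvaginDepthDoor

open Literature.NumberTheory.EllipticCurves WeierstrassCurve

/-- **Reading a Selmer count over a quadratic field against known points.** `E/ℚ` elliptic, `K`
a quadratic number field, `p` a prime, `a ≤ rank E(ℚ)`, `b ≤ rank E^{(d_K)}(ℚ)`. If
`#Sel_p(E/K) ≤ p^{a+b}` then `rank E(ℚ) = a`, `rank E^{(d_K)}(ℚ) = b`, `#E(K)[p] = 1`,
`Ш(E/K)[p] = 0` (as the subgroup `Ш ⊓ H¹(K,E)[p]`), `corank_{ℤ_p} Ш(E/K)[p^∞] = 0`,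
`corank_{ℤ_p} Ш(E/ℚ)[p^∞] = 0` and `corank_{ℤ_p} Ш(E^{(d_K)}/ℚ)[p^∞] = 0`. Descent count
(Silverman X.4.2) + `rank E(K) = rank E + rank E^{(d_K)}` (AEC Ex. 10.16) + Kummer identities +
Dokchitser–Dokchitser additivity of Selmer coranks; unconditional.
[cite: SilvermanAEC2009, Thm X.4.2 and Exercise 10.16]
[cite: DokchitserDokchitserAnnals2010, Lemma 4.14] -/
theorem rank_and_shaCorank_of_natCard_selmerGroup_baseChange_le
    (W : WeierstrassCurve ℚ) [W.IsElliptic] (K : Type) [Field K] [NumberField K]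
    (hK2 : Module.finrank ℚ K = 2) (p : ℕ) [hp : Fact p.Prime] (a b : ℕ)
    (hSel : Nat.card ↥(selmerGroup (W.baseChange K) (p : ℤ)) ≤ p ^ (a + b))
    (ha : a ≤ W.mordellWeilRank)
    (hb : b ≤ (W.quadraticTwist (NumberField.discr K : ℚ)).mordellWeilRank) :
    W.mordellWeilRank = a ∧ (W.quadraticTwist (NumberField.discr K : ℚ)).mordellWeilRank = b ∧
      Nat.card ↥(AddSubgroup.torsionBy (W.baseChange K).toAffine.Point (p : ℤ)) = 1 ∧
      (W.baseChange K).sha ⊓ AddSubgroup.torsionBy (W.baseChange K).galH1 (p : ℤ) = ⊥ ∧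
      (W.baseChange K).shaCorank p = 0 ∧ W.shaCorank p = 0 ∧
      (W.quadraticTwist (NumberField.discr K : ℚ)).shaCorank p = 0 := by
  have hpP : p.Prime := hp.out
  have hp0 : p ≠ 0 := hpP.ne_zero
  have hp1 : 1 < p := hpP.one_lt
  haveI hEK : (W.baseChange K).IsElliptic := by rw [WeierstrassCurve.baseChange]; infer_instance
  have hdK : (NumberField.discr K : ℚ) ≠ 0 := by exact_mod_cast NumberField.discr_ne_zero K
  haveI := W.isElliptic_quadraticTwist hdK
  set r := W.mordellWeilRank with hr_def
  set r' := (W.quadraticTwist (NumberField.discr K : ℚ)).mordellWeilRank with hr'_def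
  -- `rank E(K) = rank E(ℚ) + rank E^{(d_K)}(ℚ)`
  have hrk : (W.baseChange K).mordellWeilRank = r + r' :=
    mordellWeilRank_baseChange_quadratic_holds W K hK2
  -- the exact descent count over `K`
  have hcount := (W.baseChange K).natCard_selmerGroup_eq hp0
  set t := Nat.card ↥(AddSubgroup.torsionBy (W.baseChange K).toAffine.Point (p : ℤ)) with ht_def
  set u := Nat.card ↥((W.baseChange K).sha ⊓ AddSubgroup.torsionBy (W.baseChange K).galH1 (p : ℤ))
    with hu_def
  haveI hfinSel : Finite ↥(selmerGroup (W.baseChange K) (p : ℤ)) :=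
    (W.baseChange K).finite_selmerGroup_holds (by exact_mod_cast hp0)
  have hSelpos : 0 < Nat.card ↥(selmerGroup (W.baseChange K) (p : ℤ)) := Nat.card_pos
  rw [hcount, hrk] at hSel hSelpos
  -- every factor is pinned
  have ht0 : 0 < t := Nat.pos_of_ne_zero fun h ↦ by
    rw [h, mul_zero, zero_mul] at hSelpos
    exact lt_irrefl 0 hSelpos
  have hu0 : 0 < u := Nat.pos_of_ne_zero fun h ↦ by
    rw [h, mul_zero] at hSelpos
    exact lt_irrefl 0 hSelpos
  have hpow : p ^ (r + r') ≤ p ^ (a + b) := by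
    calc p ^ (r + r') ≤ p ^ (r + r') * t * u := by
          rw [mul_assoc]
          exact Nat.le_mul_of_pos_right _ (Nat.mul_pos ht0 hu0)
      _ ≤ p ^ (a + b) := hSel
  have hrr : r + r' ≤ a + b := (Nat.pow_le_pow_iff_right hp1).mp hpow
  have hra : r = a := by omega
  have hrb : r' = b := by omega
  rw [hra, hrb] at hSel
  have hppos : 0 < p ^ (a + b) := Nat.pow_pos hpP.pos
  have htu : t * u ≤ 1 := by
    have : p ^ (a + b) * (t * u) ≤ p ^ (a + b) * 1 := by rw [mul_one, ← mul_assoc]; exact hSel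
    exact Nat.le_of_mul_le_mul_left this hppos
  have ht1 : t = 1 := by nlinarith
  have hu1 : u = 1 := by nlinarith
  -- `Ш(E/K)[p] = 0`, hence `corank Ш(E/K)[p^∞] = 0`
  have hbot : (W.baseChange K).sha ⊓ AddSubgroup.torsionBy (W.baseChange K).galH1 (p : ℤ) = ⊥ :=
    AddSubgroup.card_eq_one.mp hu1
  have hshaK : (W.baseChange K).shaCorank p = 0 := by
    refine (W.baseChange K).shaCorank_eq_zero_of_forall p fun c hc hpc ↦ ?_
    have hmem : c ∈ (W.baseChange K).sha ⊓ AddSubgroup.torsionBy (W.baseChange K).galH1 (p : ℤ) :=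
      AddSubgroup.mem_inf.mpr ⟨hc, AddSubgroup.torsionBy.nsmul_iff.mpr hpc⟩
    rw [hbot] at hmem
    exact (AddSubgroup.mem_bot).mp hmem
  -- Kummer identities over `K`, `ℚ` and the twist; Dokchitser–Dokchitser additivity
  have hidK : (W.baseChange K).selmerCorank p =
      (W.baseChange K).mordellWeilRank + (W.baseChange K).shaCorank p :=
    (W.baseChange K).selmerCorank_eq_mordellWeilRank_add_holds p
  have hidQ : W.selmerCorank p = W.mordellWeilRank + W.shaCorank p :=
    W.selmerCorank_eq_mordellWeilRank_add_holds p
  have hidT : (W.quadraticTwist (NumberField.discr K : ℚ)).selmerCorank p =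
      (W.quadraticTwist (NumberField.discr K : ℚ)).mordellWeilRank +
        (W.quadraticTwist (NumberField.discr K : ℚ)).shaCorank p :=
    (W.quadraticTwist (NumberField.discr K : ℚ)).selmerCorank_eq_mordellWeilRank_add_holds p
  have hadd : (W.baseChange K).selmerCorank p =
      W.selmerCorank p + (W.quadraticTwist (NumberField.discr K : ℚ)).selmerCorank p :=
    selmerCorank_baseChange_quadratic_holds W K hK2 p
  refine ⟨hra, hrb, ht1, hbot, hshaK, ?_, ?_⟩ <;> omega

/-- **The rank-2 door read from a Selmer count.** `E/ℚ` elliptic with two independent rational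
points (`2 ≤ rank E(ℚ)`), `K` quadratic with a point of infinite order on the twist
(`1 ≤ rank E^{(d_K)}(ℚ)`), `p` prime. If `#Sel_p(E/K) ≤ p³` — the output of Kolyvagin's descent
at depth `1` from ONE non-zero derived class `c_1(ℓ) ≠ 0`
(`Literature…KolyvaginDescent.HypothesesDepth.card_sel_le_of_ne_zero`) — then
`corank_{ℤ_p} Ш(E/ℚ)[p^∞] = 0` (X1 of the route at this `p`, for this curve), and moreover
`rank E(ℚ) = 2`, `rank E^{(d_K)}(ℚ) = 1`, `E(K)[p] = 0`, `Ш(E/K)[p] = 0`,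
`corank Ш(E^{(d_K)}/ℚ)[p^∞] = 0`. Unconditional; per-curve; BSD is not proved by it.
[cite: SilvermanAEC2009, Thm X.4.2 and Exercise 10.16]
[cite: DokchitserDokchitserAnnals2010, Lemma 4.14] -/
theorem shaCorank_eq_zero_of_natCard_selmerGroup_baseChange_le_cube
    (W : WeierstrassCurve ℚ) [W.IsElliptic] (K : Type) [Field K] [NumberField K]
    (hK2 : Module.finrank ℚ K = 2) (p : ℕ) [Fact p.Prime]
    (hSel : Nat.card ↥(selmerGroup (W.baseChange K) (p : ℤ)) ≤ p ^ 3)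
    (h2 : 2 ≤ W.mordellWeilRank)
    (h1 : 1 ≤ (W.quadraticTwist (NumberField.discr K : ℚ)).mordellWeilRank) :
    W.shaCorank p = 0 ∧ W.mordellWeilRank = 2 ∧
      (W.quadraticTwist (NumberField.discr K : ℚ)).mordellWeilRank = 1 ∧
      (W.quadraticTwist (NumberField.discr K : ℚ)).shaCorank p = 0 ∧
      Nat.card ↥(AddSubgroup.torsionBy (W.baseChange K).toAffine.Point (p : ℤ)) = 1 ∧
      (W.baseChange K).sha ⊓ AddSubgroup.torsionBy (W.baseChange K).galH1 (p : ℤ) = ⊥ := by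
  obtain ⟨hra, hrb, ht, hbot, -, hsha, hshaT⟩ :=
    rank_and_shaCorank_of_natCard_selmerGroup_baseChange_le W K hK2 p 2 1 hSel h2 h1
  exact ⟨hsha, hra, hrb, hshaT, ht, hbot⟩

/-- **The same reading for an IMAGINARY quadratic `K` given as `IsImaginaryQuadratic`** (the
route's binder), `p` prime: `#Sel_p(E/K) ≤ p³`, `2 ≤ rank E(ℚ)`, `1 ≤ rank E^{(d_K)}(ℚ)` ⟹
`corank_{ℤ_p} Ш(E/ℚ)[p^∞] = 0`. [cite: SilvermanAEC2009, Thm X.4.2 and Exercise 10.16] -/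
theorem shaCorank_eq_zero_of_natCard_selmerGroup_le_cube_of_isImaginaryQuadratic
    (W : WeierstrassCurve ℚ) [W.IsElliptic] (K : Type) [Field K] [NumberField K]
    (hK : IsImaginaryQuadratic K) (p : ℕ) [Fact p.Prime]
    (hSel : Nat.card ↥(selmerGroup (W.baseChange K) (p : ℤ)) ≤ p ^ 3)
    (h2 : 2 ≤ W.mordellWeilRank)
    (h1 : 1 ≤ (W.quadraticTwist (NumberField.discr K : ℚ)).mordellWeilRank) :
    W.shaCorank p = 0 :=
  (shaCorank_eq_zero_of_natCard_selmerGroup_baseChange_le_cube W K hK.1 p hSel h2 h1).1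

end Summit.BirchSwinnertonDyer.BirchSwinnertonDyer.Theorems.KolyvaginDepthDoor

end
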